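/-
Copyright (c) 2026 the pub-hodgecm-mathlib formalisation cell (harness21).  Prover seat hodgecm-mathlib-LH10-p01 (g3): line LH4 (dyadic pay-down of `stub_N6nsDyadic`),
organ (D-SH), brick (R-dy) «RAO REGULAR CLASS AT A DYADIC PLACE», FILE 4 (LH4-plan (g3) DEALER WORDS #1∕#2); assembly bodies = ★ p849508's (LH7-p01 (g2)); 2026-09-02.
-/
import Literature.NumberTheory.Rogawski1990.UnipotentOrbitalIntegralConvergenceRegularCM   -- ★ (C) p849508 (LH7-p01): «which class» `exists_isConj_localNonsplitEquiv_eq_regularUnipotentNormalForm` (needs `(2 : L_w) ≠ 0` only); brings ★ p849197, ★ (B) p849341, ★ p849303, ★ `isMulRightInvariant_cmDatum_local_antidiagOne`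
import Literature.NumberTheory.Rogawski1990.UnipotentOrbitShellsRegularAllCM                -- ★ FILE 3 (this seat): (A′) `UnitaryGroup.exists_shells_of_regular_unipotent'` (no `2 ∈ 𝒪_w^×`)
import Literature.NumberTheory.Rogawski1990.UnipotentOrbitalIntegralConvergenceSingularCM     -- ★ (C′) p849351 (LH10-p01 (g2)): `UnitaryGroup.integrable_descConj_of_isLocSmooth_of_transvection` (hypothesis-free)
import Literature.NumberTheory.Rogawski1990.UnipotentOrbitalIntegralConvergenceCM             -- ★ FILE 4 p849278∕p849524 (LH7-p01): `Literature.MeasureTheory.Group.integrable_descConj_of_eq_one` (the class `γ = 1`)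
import HarnessLib

/-!
# Convergence of the REGULAR unipotent orbital integrals of `U(Φ₃)(L⁺_v)` at an ARBITRARY non-split place (dyadic included), and RANGA-RAO'S CLAUSE FOR EVERY UNIPOTENT
# CLASS AT EVERY NON-SPLIT PLACE — the `2 ∈ 𝒪_w^×`-free heads

Topic `NumberTheory/Rogawski1990`; namespace `Literature.NumberTheory.Rogawski1990`.  THEOREMS ONLY (no definition, no instance, no notation, no named fact, no `sorry`);
kernel lane `--supports stmt-HodgeConjecture-24833`.  Cell `pub/hodgecm-mathlib` (D-0151), crux H413 = `stmt-HodgeConjecture-24833`; half A line LH4, the DYADIC pay-down of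
the closer row `stub_N6nsDyadic` (LH4-plan (g3), skeleton v1 0447f09394670f4b `Cruxes/H413/Lines/F0_P3c_DyadicPaydown.lean` cand), organ (D-SH) «Shalika at `Φ₃` at dyadic
non-split places», brick (R-dy) «RAO REGULAR CLASS AT A DYADIC PLACE», FILE 4 of 4 (seat LH10-p01 (g3)).  = ★ (C) p849508 `UnipotentOrbitalIntegralConvergenceRegularCM` §4 and ★
`UnipotentOrbitalIntegralConvergenceCM` §3 with the hypothesis `2 ∈ 𝒪_w^×` deleted everywhere: the assembly bodies are ★'s token for token, fed with the `2`-free shells ★ FILE 3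
`UnitaryGroup.exists_shells_of_regular_unipotent'` (over ★ FILE 1 p850047 frame lemmas at `v 2 = exp(−c₂)` and ★ FILE 2 p850048 covering); «which class» (★ (C) §2) needs only
`(2 : L_w) ≠ 0`, which holds at every place; the transvection case ★ p849351 and the trivial class were already hypothesis-free.

* §1 `UnitaryGroup.measure_preimage_descConj_lt_top_of_regular_basePoint'`, `UnitaryGroup.measure_preimage_descConj_lt_top_of_regular_unipotent'`,
  `UnitaryGroup.integrable_descConj_of_isLocSmooth_of_regular_unipotent'` — the regular class at every non-split place.
* §2 **`UnitaryGroup.integrable_descConj_of_isLocSmooth_of_unipotent'`** — HCONV ∕ Ranga-Rao's clause for EVERY unipotent `u ∈ U(Φ₃)(L⁺_v)` at EVERY non-split place: the text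
  of the LH4 Shalika leaf's organ `stub_RaoConv` (`Cruxes/H413/Lines/F0_P3c_ShalikaPaydown.lean` ED. 1) with EXACTLY the token `IsUnit (2 : 𝒪[w.1.adicCompletion L]) →` removed
  (LH4-plan (g3) WORD #2 condition), so that the dyadic skeleton's ‹RAO-dy› closes BY BARE NAME.
HONEST LABEL: HC_CM is proved only modulo the 7 printed citations (2 remaining: hLiu418 = stmt-HodgeConjecture-24832, h413 = stmt-HodgeConjecture-24833) until rung 0 closes;
count-neutral (feeds the in-house road of organ (D-SH) of the closer's PRINT row «DYADIC»; nothing printed is discharged here).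

## References
* [Rao1972] R. Ranga Rao, *Orbital integrals in reductive groups*, Ann. of Math. (2) 96 (1972) 505–510: Theorem p. 505.
* [Rogawski1990] J. D. Rogawski, *Automorphic Representations of Unitary Groups in Three Variables*, Ann. of Math. Stud. 123 (1990): §3.9 Prop. 3.9.1 p. 32; §4.9 p. 54; §8.1 p. 112.
* [HarishChandra1999AdmissibleDistributions] Harish-Chandra (DeBacker–Sally), *Admissible Invariant Distributions on Reductive p-adic Groups*, AMS ULS 16 (1999): §3.1 p. 17.
-/

set_option autoImplicit false

noncomputable section

open MeasureTheory Measure NumberField IsDedekindDomain Topology Filter Set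
open Literature.MeasureTheory.Group Literature.NumberTheory.Automorphic Literature.NumberTheory.Automorphic.UnitaryGroup Literature.NumberTheory.GaloisRepresentations
open scoped Matrix MatrixGroups ValuativeRel Pointwise WithZero

namespace Literature.NumberTheory.Rogawski1990

/-! ## §1 The regular class at every non-split place -/

set_option maxHeartbeats 400000 in
-- statement-heavy: the `hbase` text (as in ★ (C) §4)
/-- = ★ `UnitaryGroup.measure_preimage_descConj_lt_top_of_regular_basePoint` with the hypothesis `2 ∈ 𝒪_w^×` deleted.
**THE BASE-POINT FINITENESS at every non-split place**: for `γ₀ ∈ U(Φ₃)(L⁺_v)` with `ψ γ₀ = u(1, −1∕2)`, every `G`-invariant measure `μ` on `G ⧸ C(γ₀)` finite on compacta and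
every compact `C ⊆ G`, `μ {yC(γ₀) ∣ y γ₀ y⁻¹ ∈ C} < ⊤` — ★ FILE 3 (A′) shells ⟶ ★ (B)′ `measure_biUnion_image_mk_mul_lt_top_of_shells'` at `H := C(γ₀)`, `K := U(Φ₃)(𝒪_v)`,
`ν := Measure.haar` ⟶ monotonicity (★ (C)'s body verbatim). [cite: Rao1972, Theorem p. 505] [cite: Rogawski1990, §8.1 p. 112; §4.9 p. 54] -/
theorem UnitaryGroup.measure_preimage_descConj_lt_top_of_regular_basePoint' :
    ∀ (L : Type) [Field L] [NumberField L] [IsCMField L] (v : HeightOneSpectrum (𝓞 ↥(maximalRealSubfield L))) (w : UnitaryGroup.PlacesOver L v)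
      (hsub : Subsingleton (UnitaryGroup.PlacesOver L v)),
      ∀ [MeasurableSpace ((cmDatum L 3 (Matrix.of fun i j : Fin 3 => if i.val + j.val + 1 = 3 then (1 : L) else 0)).Local v)] [BorelSpace ((cmDatum L 3 (Matrix.of fun i j : Fin 3 => if i.val + j.val + 1 = 3 then (1 : L) else 0)).Local v)]
        [∀ γ : ((cmDatum L 3 (Matrix.of fun i j : Fin 3 => if i.val + j.val + 1 = 3 then (1 : L) else 0)).Local v), MeasurableSpace (((cmDatum L 3 (Matrix.of fun i j : Fin 3 => if i.val + j.val + 1 = 3 then (1 : L) else 0)).Local v) ⧸ Subgroup.centralizer ({γ} : Set ((cmDatum L 3 (Matrix.of fun i j : Fin 3 => if i.val + j.val + 1 = 3 then (1 : L) else 0)).Local v)))]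
        [∀ γ : ((cmDatum L 3 (Matrix.of fun i j : Fin 3 => if i.val + j.val + 1 = 3 then (1 : L) else 0)).Local v), BorelSpace (((cmDatum L 3 (Matrix.of fun i j : Fin 3 => if i.val + j.val + 1 = 3 then (1 : L) else 0)).Local v) ⧸ Subgroup.centralizer ({γ} : Set ((cmDatum L 3 (Matrix.of fun i j : Fin 3 => if i.val + j.val + 1 = 3 then (1 : L) else 0)).Local v)))],
      ∀ (γ₀ : ((cmDatum L 3 (Matrix.of fun i j : Fin 3 => if i.val + j.val + 1 = 3 then (1 : L) else 0)).Local v)),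
        ((((localNonsplitEquiv (IsCMField.complexConj L) (Matrix.of fun i j : Fin 3 => if i.val + j.val + 1 = 3 then (1 : L) else 0) (IsCMField.complexConj_ne_one L) w (smul_placesOver_eq_of_subsingleton L v (IsCMField.complexConj L) hsub w) γ₀ : ↥(unitaryGroupOfForm (galAdicCompletionMap (L := L) (IsCMField.complexConj L) (smul_placesOver_eq_of_subsingleton L v (IsCMField.complexConj L) hsub w)) (placeForm (Matrix.of fun i j : Fin 3 => if i.val + j.val + 1 = 3 then (1 : L) else 0) w.1))) : GL (Fin 3) (w.1.adicCompletion L))) : Matrix (Fin 3) (Fin 3) (w.1.adicCompletion L)) = !![1, 1, -2⁻¹; 0, 1, -1; 0, 0, 1] →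
      ∀ (μ : Measure (((cmDatum L 3 (Matrix.of fun i j : Fin 3 => if i.val + j.val + 1 = 3 then (1 : L) else 0)).Local v) ⧸ (Subgroup.centralizer ({γ₀} : Set ((cmDatum L 3 (Matrix.of fun i j : Fin 3 => if i.val + j.val + 1 = 3 then (1 : L) else 0)).Local v)))))
        [SMulInvariantMeasure ((cmDatum L 3 (Matrix.of fun i j : Fin 3 => if i.val + j.val + 1 = 3 then (1 : L) else 0)).Local v) (((cmDatum L 3 (Matrix.of fun i j : Fin 3 => if i.val + j.val + 1 = 3 then (1 : L) else 0)).Local v) ⧸ (Subgroup.centralizer ({γ₀} : Set ((cmDatum L 3 (Matrix.of fun i j : Fin 3 => if i.val + j.val + 1 = 3 then (1 : L) else 0)).Local v)))) μ] [IsFiniteMeasureOnCompacts μ] (C : Set ((cmDatum L 3 (Matrix.of fun i j : Fin 3 => if i.val + j.val + 1 = 3 then (1 : L) else 0)).Local v)), IsCompact C →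
        μ (descConj γ₀ (Subgroup.centralizer ({γ₀} : Set ((cmDatum L 3 (Matrix.of fun i j : Fin 3 => if i.val + j.val + 1 = 3 then (1 : L) else 0)).Local v))) (fun _ hg => Subgroup.mem_centralizer_singleton_iff.1 hg) id ⁻¹' C) < ⊤ := by
  intro L _ _ _ v w hsub _ _ _ _ γ₀ hγ₀ μ _ _ C hC
  obtain ⟨j₀, N, x, S, c₃, -, -, hSc, hS₀, hle, habs, hgr, hcov⟩ :=
    UnitaryGroup.exists_shells_of_regular_unipotent' L v w (smul_placesOver_eq_of_subsingleton L v (IsCMField.complexConj L) hsub w) γ₀ hγ₀ C hC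
  have hK := isCompact_isOpen_cmLocalIntegralLevel L 3 (Matrix.of fun i j : Fin 3 => if i.val + j.val + 1 = 3 then (1 : L) else 0) v
  haveI : IsClosed (((Subgroup.centralizer ({γ₀} : Set ((cmDatum L 3 (Matrix.of fun i j : Fin 3 => if i.val + j.val + 1 = 3 then (1 : L) else 0)).Local v))) : Subgroup ((cmDatum L 3 (Matrix.of fun i j : Fin 3 => if i.val + j.val + 1 = 3 then (1 : L) else 0)).Local v)) : Set ((cmDatum L 3 (Matrix.of fun i j : Fin 3 => if i.val + j.val + 1 = 3 then (1 : L) else 0)).Local v)) := Set.isClosed_centralizer _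
  haveI := isMulRightInvariant_cmDatum_local_antidiagOne L 3 v
    (Measure.haar : Measure ((cmDatum L 3 (Matrix.of fun i j : Fin 3 => if i.val + j.val + 1 = 3 then (1 : L) else 0)).Local v))
  have hbound := measure_biUnion_image_mk_mul_lt_top_of_shells' (Subgroup.centralizer ({γ₀} : Set ((cmDatum L 3 (Matrix.of fun i j : Fin 3 => if i.val + j.val + 1 = 3 then (1 : L) else 0)).Local v))) μ (Measure.haar : Measure ((cmDatum L 3 (Matrix.of fun i j : Fin 3 => if i.val + j.val + 1 = 3 then (1 : L) else 0)).Local v)) (cmLocalIntegralLevel L 3 (Matrix.of fun i j : Fin 3 => if i.val + j.val + 1 = 3 then (1 : L) else 0) v) hK.2 hK.1 j₀ N x S c₃ hSc hS₀ hle habs hgr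
  refine lt_of_le_of_lt (measure_mono ?_) hbound
  intro y hy
  induction y using QuotientGroup.induction_on with
  | H g =>
    have hg : g ∈ {y : ((cmDatum L 3 (Matrix.of fun i j : Fin 3 => if i.val + j.val + 1 = 3 then (1 : L) else 0)).Local v) | y * γ₀ * y⁻¹ ∈ C} := hy
    have hg' := hcov hg
    simp only [mem_iUnion, mem_setOf_eq, exists_prop] at hg'
    obtain ⟨j, hj, q, hq, hmem⟩ := hg'
    obtain ⟨a, ha, c, hc, rfl⟩ := Set.mem_mul.1 hmem
    simp only [mem_iUnion, mem_setOf_eq, exists_prop]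
    refine ⟨j, hj, q, hq, a, ha, ?_⟩
    exact (QuotientGroup.mk_mul_of_mem a hc).symm

set_option maxHeartbeats 400000 in
-- statement-heavy: four instance binders
/-- = ★ `UnitaryGroup.measure_preimage_descConj_lt_top_of_regular_unipotent` with the hypothesis `2 ∈ 𝒪_w^×` deleted.
**THE REGULAR CASE, MEASURE LEVEL, at every non-split place**: for every REGULAR unipotent `γ ∈ U(Φ₃)(L⁺_v)` (`(γ − 1)³ = 0 ≠ (γ − 1)²`), every `G`-invariant measure `μ` on
`G ⧸ C(γ)` finite on compacta and every compact `C ⊆ G`, `μ {yC(γ) ∣ y γ y⁻¹ ∈ C} < ⊤` (★ (C) §2 «which class» — `(2 : L_w) ≠ 0` holds since `L_w ⊇ ℚ` — + the base-point finiteness +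
★ p849303 `measure_preimage_descConj_lt_top_of_isConj`). [cite: Rao1972, Theorem p. 505] [cite: Rogawski1990, §3.9 Prop. 3.9.1 p. 32; §4.9 p. 54; §8.1 p. 112] -/
theorem UnitaryGroup.measure_preimage_descConj_lt_top_of_regular_unipotent'
    (L : Type) [Field L] [NumberField L] [IsCMField L] (v : HeightOneSpectrum (𝓞 ↥(maximalRealSubfield L))) (w : UnitaryGroup.PlacesOver L v)
    (hsub : Subsingleton (UnitaryGroup.PlacesOver L v))
    [MeasurableSpace ((cmDatum L 3 (Matrix.of fun i j : Fin 3 => if i.val + j.val + 1 = 3 then (1 : L) else 0)).Local v)] [BorelSpace ((cmDatum L 3 (Matrix.of fun i j : Fin 3 => if i.val + j.val + 1 = 3 then (1 : L) else 0)).Local v)]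
    [∀ γ : ((cmDatum L 3 (Matrix.of fun i j : Fin 3 => if i.val + j.val + 1 = 3 then (1 : L) else 0)).Local v), MeasurableSpace (((cmDatum L 3 (Matrix.of fun i j : Fin 3 => if i.val + j.val + 1 = 3 then (1 : L) else 0)).Local v) ⧸ Subgroup.centralizer ({γ} : Set ((cmDatum L 3 (Matrix.of fun i j : Fin 3 => if i.val + j.val + 1 = 3 then (1 : L) else 0)).Local v)))]
    [∀ γ : ((cmDatum L 3 (Matrix.of fun i j : Fin 3 => if i.val + j.val + 1 = 3 then (1 : L) else 0)).Local v), BorelSpace (((cmDatum L 3 (Matrix.of fun i j : Fin 3 => if i.val + j.val + 1 = 3 then (1 : L) else 0)).Local v) ⧸ Subgroup.centralizer ({γ} : Set ((cmDatum L 3 (Matrix.of fun i j : Fin 3 => if i.val + j.val + 1 = 3 then (1 : L) else 0)).Local v)))]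
    (γ : ((cmDatum L 3 (Matrix.of fun i j : Fin 3 => if i.val + j.val + 1 = 3 then (1 : L) else 0)).Local v)) (hγ : ((γ.val : GL (Fin 3) (UnitaryGroup.LocalRing L v)).val - 1) ^ 3 = 0) (hreg : ((γ.val : GL (Fin 3) (UnitaryGroup.LocalRing L v)).val - 1) ^ 2 ≠ 0)
    (μ : Measure (((cmDatum L 3 (Matrix.of fun i j : Fin 3 => if i.val + j.val + 1 = 3 then (1 : L) else 0)).Local v) ⧸ (Subgroup.centralizer ({γ} : Set ((cmDatum L 3 (Matrix.of fun i j : Fin 3 => if i.val + j.val + 1 = 3 then (1 : L) else 0)).Local v)))))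
    [SMulInvariantMeasure ((cmDatum L 3 (Matrix.of fun i j : Fin 3 => if i.val + j.val + 1 = 3 then (1 : L) else 0)).Local v) (((cmDatum L 3 (Matrix.of fun i j : Fin 3 => if i.val + j.val + 1 = 3 then (1 : L) else 0)).Local v) ⧸ (Subgroup.centralizer ({γ} : Set ((cmDatum L 3 (Matrix.of fun i j : Fin 3 => if i.val + j.val + 1 = 3 then (1 : L) else 0)).Local v)))) μ] [IsFiniteMeasureOnCompacts μ]
    (C : Set ((cmDatum L 3 (Matrix.of fun i j : Fin 3 => if i.val + j.val + 1 = 3 then (1 : L) else 0)).Local v)) (hC : IsCompact C) :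
    μ ((descConj γ (Subgroup.centralizer ({γ} : Set ((cmDatum L 3 (Matrix.of fun i j : Fin 3 => if i.val + j.val + 1 = 3 then (1 : L) else 0)).Local v))) (fun _ hg => Subgroup.mem_centralizer_singleton_iff.1 hg) id) ⁻¹' C) < ⊤ := by
  have h2K : (2 : w.1.adicCompletion L) ≠ 0 := by
    rw [← map_ofNat (algebraMap L (w.1.adicCompletion L)) 2]
    exact (map_ne_zero (algebraMap L (w.1.adicCompletion L))).2 two_ne_zero
  obtain ⟨γ₀, hψ, hc⟩ := exists_isConj_localNonsplitEquiv_eq_regularUnipotentNormalForm L w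
    (smul_placesOver_eq_of_subsingleton L v (IsCMField.complexConj L) hsub w) hsub h2K γ hγ hreg
  exact measure_preimage_descConj_lt_top_of_isConj
    (fun μ₀ _ _ C' hC' => UnitaryGroup.measure_preimage_descConj_lt_top_of_regular_basePoint' L v w hsub γ₀ hψ μ₀ C' hC') hc μ hC

set_option maxHeartbeats 400000 in
-- statement-heavy: four instance binders
/-- = ★ `UnitaryGroup.integrable_descConj_of_isLocSmooth_of_regular_unipotent` with the hypothesis `2 ∈ 𝒪_w^×` deleted.
**THE REGULAR CASE OF RANGA-RAO'S CLAUSE at every non-split place** (binders `(L)(v)(w)(hsub)[4 inst](γ)(hγ)(hreg)(μ)[inv][fin](f)(hf)`): for a REGULAR unipotent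
`γ ∈ U(Φ₃)(L⁺_v)`, every `G`-invariant measure `μ` on `G ⧸ C(γ)` finite on compacta and every `f ∈ C_c^∞(G)`, the orbital integrand `y C(γ) ↦ f(y γ y⁻¹)` is `μ`-integrable
(★ p849197 `integrable_descConj_of_measure_preimage_lt_top` over the measure-level head). [cite: Rao1972, Theorem p. 505] [cite: Rogawski1990, §3.9 Prop. 3.9.1 p. 32; §4.9 p. 54; §8.1 p. 112]
[cite: HarishChandra1999AdmissibleDistributions, §3.1 p. 17] -/
theorem UnitaryGroup.integrable_descConj_of_isLocSmooth_of_regular_unipotent'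
    (L : Type) [Field L] [NumberField L] [IsCMField L] (v : HeightOneSpectrum (𝓞 ↥(maximalRealSubfield L))) (w : UnitaryGroup.PlacesOver L v)
    (hsub : Subsingleton (UnitaryGroup.PlacesOver L v))
    [MeasurableSpace ((cmDatum L 3 (Matrix.of fun i j : Fin 3 => if i.val + j.val + 1 = 3 then (1 : L) else 0)).Local v)] [BorelSpace ((cmDatum L 3 (Matrix.of fun i j : Fin 3 => if i.val + j.val + 1 = 3 then (1 : L) else 0)).Local v)]
    [∀ γ : ((cmDatum L 3 (Matrix.of fun i j : Fin 3 => if i.val + j.val + 1 = 3 then (1 : L) else 0)).Local v), MeasurableSpace (((cmDatum L 3 (Matrix.of fun i j : Fin 3 => if i.val + j.val + 1 = 3 then (1 : L) else 0)).Local v) ⧸ Subgroup.centralizer ({γ} : Set ((cmDatum L 3 (Matrix.of fun i j : Fin 3 => if i.val + j.val + 1 = 3 then (1 : L) else 0)).Local v)))]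
    [∀ γ : ((cmDatum L 3 (Matrix.of fun i j : Fin 3 => if i.val + j.val + 1 = 3 then (1 : L) else 0)).Local v), BorelSpace (((cmDatum L 3 (Matrix.of fun i j : Fin 3 => if i.val + j.val + 1 = 3 then (1 : L) else 0)).Local v) ⧸ Subgroup.centralizer ({γ} : Set ((cmDatum L 3 (Matrix.of fun i j : Fin 3 => if i.val + j.val + 1 = 3 then (1 : L) else 0)).Local v)))]
    (γ : ((cmDatum L 3 (Matrix.of fun i j : Fin 3 => if i.val + j.val + 1 = 3 then (1 : L) else 0)).Local v)) (hγ : ((γ.val : GL (Fin 3) (UnitaryGroup.LocalRing L v)).val - 1) ^ 3 = 0) (hreg : ((γ.val : GL (Fin 3) (UnitaryGroup.LocalRing L v)).val - 1) ^ 2 ≠ 0)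
    (μ : Measure (((cmDatum L 3 (Matrix.of fun i j : Fin 3 => if i.val + j.val + 1 = 3 then (1 : L) else 0)).Local v) ⧸ (Subgroup.centralizer ({γ} : Set ((cmDatum L 3 (Matrix.of fun i j : Fin 3 => if i.val + j.val + 1 = 3 then (1 : L) else 0)).Local v)))))
    [SMulInvariantMeasure ((cmDatum L 3 (Matrix.of fun i j : Fin 3 => if i.val + j.val + 1 = 3 then (1 : L) else 0)).Local v) (((cmDatum L 3 (Matrix.of fun i j : Fin 3 => if i.val + j.val + 1 = 3 then (1 : L) else 0)).Local v) ⧸ (Subgroup.centralizer ({γ} : Set ((cmDatum L 3 (Matrix.of fun i j : Fin 3 => if i.val + j.val + 1 = 3 then (1 : L) else 0)).Local v)))) μ] [IsFiniteMeasureOnCompacts μ]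
    (f : ((cmDatum L 3 (Matrix.of fun i j : Fin 3 => if i.val + j.val + 1 = 3 then (1 : L) else 0)).Local v) → ℂ) (hf : IsLocSmooth f) :
    Integrable (descConj γ (Subgroup.centralizer ({γ} : Set ((cmDatum L 3 (Matrix.of fun i j : Fin 3 => if i.val + j.val + 1 = 3 then (1 : L) else 0)).Local v))) (fun _ hg => Subgroup.mem_centralizer_singleton_iff.1 hg) f) μ :=
  integrable_descConj_of_measure_preimage_lt_top γ (Subgroup.centralizer ({γ} : Set ((cmDatum L 3 (Matrix.of fun i j : Fin 3 => if i.val + j.val + 1 = 3 then (1 : L) else 0)).Local v))) (fun _ hg => Subgroup.mem_centralizer_singleton_iff.1 hg) μ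
    (fun C hC => UnitaryGroup.measure_preimage_descConj_lt_top_of_regular_unipotent' L v w hsub γ hγ hreg μ C hC)
    hf.continuous hf.hasCompactSupport

/-! ## §2 Ranga-Rao's clause for every unipotent class at every non-split place -/

set_option maxHeartbeats 400000 in
-- statement-heavy: the HCONV binders
/-- = ★ `UnitaryGroup.integrable_descConj_of_isLocSmooth_of_unipotent` with the hypothesis `2 ∈ 𝒪_w^×` deleted.
**RANGA-RAO'S CLAUSE FOR `U(Φ₃)(L⁺_v)` AT EVERY NON-SPLIT PLACE, DYADIC INCLUDED — HCONV.**  For every UNIPOTENT `u ∈ G = U(Φ₃)(L⁺_v)` (`(u − 1)³ = 0`), every `G`-invariant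
measure `μ` on `G ⧸ C(u)` finite on compacta and every `f ∈ C_c^∞(G)`, the orbital integrand `y C(u) ↦ f(y u y⁻¹)` is `μ`-integrable.  TEXT = the LH4 Shalika leaf's organ
`stub_RaoConv` (`Cruxes/H413/Lines/F0_P3c_ShalikaPaydown.lean` ED. 1 :179–197) with exactly the token `IsUnit (2 : 𝒪[w.1.adicCompletion L]) →` removed.  Proof = the three-way
split of ★ `…_of_unipotent_of_cases`: `u = 1` (★ `integrable_descConj_of_eq_one`), `(u − 1)² ≠ 0` (§1), `(u − 1)² = 0 ∧ u ≠ 1` (★ p849351 transvection, hypothesis-free).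
[cite: Rao1972, Theorem p. 505] [cite: Rogawski1990, §8.1 p. 112; §4.9 p. 54; §3.9 Prop. 3.9.1 p. 32] [cite: HarishChandra1999AdmissibleDistributions, §3.1 p. 17] -/
theorem UnitaryGroup.integrable_descConj_of_isLocSmooth_of_unipotent' :
    ∀ (L : Type) [Field L] [NumberField L] [IsCMField L] (v : HeightOneSpectrum (𝓞 ↥(maximalRealSubfield L))) (w : UnitaryGroup.PlacesOver L v),
    Subsingleton (UnitaryGroup.PlacesOver L v) →
    ∀ [MeasurableSpace ((cmDatum L 3 (Matrix.of fun i j : Fin 3 => if i.val + j.val + 1 = 3 then (1 : L) else 0)).Local v)] [BorelSpace ((cmDatum L 3 (Matrix.of fun i j : Fin 3 => if i.val + j.val + 1 = 3 then (1 : L) else 0)).Local v)]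
      [∀ γ : ((cmDatum L 3 (Matrix.of fun i j : Fin 3 => if i.val + j.val + 1 = 3 then (1 : L) else 0)).Local v), MeasurableSpace (((cmDatum L 3 (Matrix.of fun i j : Fin 3 => if i.val + j.val + 1 = 3 then (1 : L) else 0)).Local v) ⧸ Subgroup.centralizer ({γ} : Set ((cmDatum L 3 (Matrix.of fun i j : Fin 3 => if i.val + j.val + 1 = 3 then (1 : L) else 0)).Local v)))]
      [∀ γ : ((cmDatum L 3 (Matrix.of fun i j : Fin 3 => if i.val + j.val + 1 = 3 then (1 : L) else 0)).Local v), BorelSpace (((cmDatum L 3 (Matrix.of fun i j : Fin 3 => if i.val + j.val + 1 = 3 then (1 : L) else 0)).Local v) ⧸ Subgroup.centralizer ({γ} : Set ((cmDatum L 3 (Matrix.of fun i j : Fin 3 => if i.val + j.val + 1 = 3 then (1 : L) else 0)).Local v)))],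
    ∀ (u : ((cmDatum L 3 (Matrix.of fun i j : Fin 3 => if i.val + j.val + 1 = 3 then (1 : L) else 0)).Local v)),
      (((u.val : GL (Fin 3) (UnitaryGroup.LocalRing L v)).val - 1) ^ 3 = 0) →
      ∀ (μ : Measure (((cmDatum L 3 (Matrix.of fun i j : Fin 3 => if i.val + j.val + 1 = 3 then (1 : L) else 0)).Local v) ⧸ Subgroup.centralizer ({u} : Set ((cmDatum L 3 (Matrix.of fun i j : Fin 3 => if i.val + j.val + 1 = 3 then (1 : L) else 0)).Local v))))
        [SMulInvariantMeasure ((cmDatum L 3 (Matrix.of fun i j : Fin 3 => if i.val + j.val + 1 = 3 then (1 : L) else 0)).Local v)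
          (((cmDatum L 3 (Matrix.of fun i j : Fin 3 => if i.val + j.val + 1 = 3 then (1 : L) else 0)).Local v) ⧸ Subgroup.centralizer ({u} : Set ((cmDatum L 3 (Matrix.of fun i j : Fin 3 => if i.val + j.val + 1 = 3 then (1 : L) else 0)).Local v))) μ]
        [IsFiniteMeasureOnCompacts μ],
      ∀ f : ((cmDatum L 3 (Matrix.of fun i j : Fin 3 => if i.val + j.val + 1 = 3 then (1 : L) else 0)).Local v) → ℂ, IsLocSmooth f →
        Integrable (descConj u (Subgroup.centralizer ({u} : Set ((cmDatum L 3 (Matrix.of fun i j : Fin 3 => if i.val + j.val + 1 = 3 then (1 : L) else 0)).Local v)))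
          (fun _ hg => Subgroup.mem_centralizer_singleton_iff.1 hg) f) μ := by
  intro L _ _ _ v w hsub _ _ _ _ u hu μ _ _ f hf
  by_cases hu1 : u = 1
  · subst hu1
    exact Literature.MeasureTheory.Group.integrable_descConj_of_eq_one μ f
  · by_cases hreg : ((u.val : GL (Fin 3) (UnitaryGroup.LocalRing L v)).val - 1) ^ 2 = 0
    · exact UnitaryGroup.integrable_descConj_of_isLocSmooth_of_transvection L v w hsub u hreg hu1 μ f hf
    · exact UnitaryGroup.integrable_descConj_of_isLocSmooth_of_regular_unipotent' L v w hsub u hu hreg μ f hf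

end Literature.NumberTheory.Rogawski1990

end
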